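import Summits.Parity.BatemanHorn.Theses.AlmostPrimeZeros
import Literature.NumberTheory.LFunctions.SelbergDelangeRieszExpansion
import Summits.Parity.BatemanHorn.Theorems.AlmostPrimeZerosLinearCappedRepulsionRankinMajorant
import Summits.Parity.BatemanHorn.Theorems.AlmostPrimeZerosLinearCappedRepulsionJensenCount
import Summits.Parity.BatemanHorn.Theorems.AlmostPrimeZerosLinearCappedRepulsionStieltjes
import Summits.Parity.BatemanHorn.Theorems.AlmostPrimeZerosLinearCappedRepulsionShortIntervalCapped
import Summits.Parity.BatemanHorn.Theorems.AlmostPrimeZerosLinearCappedRepulsionCappedEulerData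
import Summits.Parity.BatemanHorn.Theorems.AlmostPrimeZerosLinearCappedRepulsionRieszDiffEngine

/-!
# Line `jensen-stieltjes-majorant` — crux stmt-Parity-11327
(`Summit.Parity.BatemanHorn.Theses.AlmostPrimeZeros.LinearCappedRepulsion`, route AlmostPrimeZeros, rank 5)

Crux: `∃ C, ∀ x ≥ 2, T(x) := Σ_ρ ‖1 − ρ‖⁻² ≤ C`, the sum over the roots (with multiplicity) of the
almost-prime polynomial `P_x(z) = Σ_{0 ≤ n ≤ x} z^{s(n)}`, `s(n) = Σ_{p^v ∥ n} min(v, 2)`.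

Notation (docstrings only): `𝓛 = log x`, `L = log log x`, `w = z − 1`, `r = ‖w‖`,
`N(t) = #{ρ : ‖1 − ρ‖ ≤ t}` (with multiplicity), `A(y) = Σ_{1 ≤ n ≤ y} z^{s(n)}`,
`A₁(y) = Σ_{1 ≤ n ≤ y} z^{s(n)} (y − n)` (Riesz mean of order one).

The line (planner skeleton of 2026-08-16, RESHAPED by the lead the same day, L1/L4 — same composition
idea, the analytic stub cut into three registered stubs whose composition is PROVED below):
a ONE-SIDED majorant of `P_x` carrying the HARMONIC exponent `(log x)^{Re z − 1}` on the disc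
`‖z − 1‖ ≤ L/C` (`tiltedMajorant`, now a theorem modulo `stub_cappedEulerData`,
`stub_rieszDiffEngine`, `stub_shortIntervalCapped`, `stub_rankinMajorant`), the elementary Rankin
majorant on the rest of the plane (`stub_rankinMajorant`), Jensen's formula at the free centre `z = 1`
(`stub_jensenCount`) and the Stieltjes/layer-cake conversion (`stub_stieltjes`).

How the tilted majorant is obtained (one-sided Selberg–Delange, no main term, no Hankel evaluation, no
Taylor expansion at the branch point): `stub_cappedEulerData` supplies the hypotheses
`SelbergDelange.RieszData R (4/5) B z (n ↦ z^{s(n)}) G` of the tree's contour engine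
(`Literature/NumberTheory/LFunctions/SelbergDelangeRieszExpansion.lean`) with the EXPLICIT bound
`B = exp(b (1+R)^{3/2})` (the capped Euler factor is a polynomial in `z`: no `R < 2` wall);
`stub_rieszDiffEngine` bounds the DIFFERENCE of two Riesz means `A₁(x+h) − A₁(x)`
(`x e^{−L³} ≤ h ≤ x`) by `h·x·𝓛^{Re z−1}·B·e^{c(1+R)^{3/2}}` through the keyhole contour of MV p. 178
(tails / horizontal sides / left sides bounded piecewise by the tree lemmas with `T = exp(3L³)`,
`b = 1 − 2c̄/log(T+3)`; the keyhole bounded as a difference, gaining `h/x` from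
`(x+h)^{1+s} − x^{1+s}`); `stub_shortIntervalCapped` kills the de-smoothing error
`Σ_{x<n≤x+h} R^{s(n)} ≤ x 𝓛^{−R−1}` by the split `s(n) ≤ K' ∨ s(n) > K'`, `K' ≍ L²`, fed by
`stub_rankinMajorant`; `tiltedMajorant_of_parts` assembles
`A(x) = (A₁(x+h) − A₁(x))/h − h⁻¹Σ_{x<n≤x+h} z^{s(n)}(x+h−n)` with `R := 1 + ‖z − 1‖`.

Stubs (all LANDED as `Theorems/AlmostPrimeZerosLinearCappedRepulsion*.lean`, imported above; this file is sorry-free):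
* `stub_cappedEulerData`     — Euler product of the capped statistic: `RieszData` with explicit `B(R)`.
* `stub_rieszDiffEngine`     — analytic, HARDEST (lead): the one-sided contour bound for `A₁(x+h) − A₁(x)`.
* `stub_shortIntervalCapped` — elementary: short sums of `R^{s(n)}` from the Rankin majorant.
* `stub_rankinMajorant`      — elementary (Rankin's trick + Mertens).
* `stub_jensenCount`         — pure complex analysis over `Polynomial ℂ` (Jensen at `z = 1`).
* `stub_stieltjes`           — pure real analysis over a finite multiset (layer cake).
* `tiltedMajorant_of_parts`, `tiltedMajorant`, `LinearCappedRepulsion_of_stubs` — PROVED compositions;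
* `LinearCappedRepulsion_of` — the theorem: the route decl BY NAME.
-/

namespace Summit.Parity.BatemanHorn.Cruxes.LinearCappedRepulsion.JensenStieltjesMajorant

open scoped BigOperators
open Literature.NumberTheory.LFunctions

-- Stub 1a `stub_cappedEulerData` LANDED: imported from
-- `Summits.Parity.BatemanHorn.Theorems.AlmostPrimeZerosLinearCappedRepulsionCappedEulerData`.
-- Stub 1b `stub_rieszDiffEngine` LANDED: imported from
-- `Summits.Parity.BatemanHorn.Theorems.AlmostPrimeZerosLinearCappedRepulsionRieszDiffEngine`.
-- Stub 1c `stub_shortIntervalCapped` LANDED (p73489): imported from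
-- `Summits.Parity.BatemanHorn.Theorems.AlmostPrimeZerosLinearCappedRepulsionShortIntervalCapped`.

-- Stub 2 `stub_rankinMajorant` LANDED (p73065): imported from
-- `Summits.Parity.BatemanHorn.Theorems.AlmostPrimeZerosLinearCappedRepulsionRankinMajorant`.

-- Stub 3 `stub_jensenCount` LANDED (p73306): imported from
-- `Summits.Parity.BatemanHorn.Theorems.AlmostPrimeZerosLinearCappedRepulsionJensenCount`.

-- Stub 4 `stub_stieltjes` LANDED (p73330): imported from
-- `Summits.Parity.BatemanHorn.Theorems.AlmostPrimeZerosLinearCappedRepulsionStieltjes`.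

/-- **Composition (kernel-checked, no `sorry`): the four stub STATEMENTS imply the crux statement.**
(The conclusion is the body of the route decl verbatim; `LinearCappedRepulsion_of` below instantiates it
with the registered stubs and concludes the route decl BY NAME.)
Bookkeeping: for `x ≥ X := max x₀ (max 3 ⌈exp(exp C)⌉)` one has `L := log log x ≥ C > 0`; apply
`stub_jensenCount` to `P := P_x` with `Λ := L`, `Λ' := B·L`, `R₁ := L/C ≥ 1` — the disc majorant is
`stub_tiltedMajorant` verbatim (`P_x(1) = x + 1`), the global majorant is `stub_rankinMajorant` at
`y := 1 + ‖z − 1‖ ≥ ‖z‖` through `‖Σ z^{s(n)}‖ ≤ Σ ‖z‖^{s(n)} ≤ Σ y^{s(n)}` — then `stub_stieltjes`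
with `K₀ := C + B·C` (`Λ + Λ' = (1 + B)L = K₀·R₁`), `r₀ := e^{−3A}`.  For `x < X` the finitely many
real numbers `T(x)` are bounded by `Σ_{x' < X} |T(x')|`. -/
theorem LinearCappedRepulsion_of_stubs :
    (∃ A : ℝ, 0 ≤ A ∧ ∃ C : ℝ, 0 < C ∧ ∃ x₀ : ℕ, ∀ x : ℕ, x₀ ≤ x → ∀ z : ℂ,
      ‖z - 1‖ ≤ Real.log (Real.log x) / C →
      ‖∑ n ∈ Finset.range (x + 1), z ^ (n.factorization.sum fun _ v => min v 2)‖ ≤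
        ((x : ℝ) + 1) * Real.exp (Real.log (Real.log x) * (z.re - 1) + A * (1 + ‖z - 1‖) ^ (3 / 2 : ℝ))) →
    (∃ B : ℝ, 0 ≤ B ∧ ∀ x : ℕ, 3 ≤ x → ∀ y : ℝ, 1 ≤ y →
      ∑ n ∈ Finset.range (x + 1), y ^ (n.factorization.sum fun _ v => min v 2) ≤
        ((x : ℝ) + 1) * Real.exp (B * y * Real.log (Real.log x) + B * y ^ (3 / 2 : ℝ))) →
    (∀ (P : Polynomial ℂ) (Λ Λ' R₁ A B : ℝ), P.eval 1 ≠ 0 → 0 ≤ Λ → 0 ≤ Λ' → 1 ≤ R₁ → 0 ≤ A → 0 ≤ B →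
      (∀ z : ℂ, ‖z - 1‖ ≤ R₁ →
        ‖P.eval z‖ ≤ ‖P.eval 1‖ * Real.exp (Λ * (z.re - 1) + A * (1 + ‖z - 1‖) ^ (3 / 2 : ℝ))) →
      (∀ z : ℂ, ‖P.eval z‖ ≤ ‖P.eval 1‖ * Real.exp (Λ' * (1 + ‖z - 1‖) + B * (1 + ‖z - 1‖) ^ (3 / 2 : ℝ))) →
      (∀ ρ ∈ P.roots, Real.exp (-(3 * A)) ≤ ‖(1 : ℂ) - ρ‖) ∧
      (∀ t : ℝ, 0 < t → Real.exp 1 * t ≤ R₁ →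
        ((P.roots.filter fun ρ : ℂ => ‖(1 : ℂ) - ρ‖ ≤ t).card : ℝ) ≤ A * (1 + Real.exp 1 * t) ^ (3 / 2 : ℝ)) ∧
      (∀ t : ℝ, 0 < t →
        ((P.roots.filter fun ρ : ℂ => ‖(1 : ℂ) - ρ‖ ≤ t).card : ℝ) ≤
          (Λ + Λ') * (1 + Real.exp 1 * t) + B * (1 + Real.exp 1 * t) ^ (3 / 2 : ℝ))) →
    (∀ (A B K₀ r₀ : ℝ), 0 ≤ A → 0 ≤ B → 0 ≤ K₀ → 0 < r₀ → ∃ K : ℝ, ∀ (S : Multiset ℂ) (M R₁ : ℝ),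
      0 ≤ M → 1 ≤ R₁ → M ≤ K₀ * R₁ →
      (∀ ρ ∈ S, r₀ ≤ ‖(1 : ℂ) - ρ‖) →
      (∀ t : ℝ, 0 < t → Real.exp 1 * t ≤ R₁ →
        ((S.filter fun ρ : ℂ => ‖(1 : ℂ) - ρ‖ ≤ t).card : ℝ) ≤ A * (1 + Real.exp 1 * t) ^ (3 / 2 : ℝ)) →
      (∀ t : ℝ, 0 < t →
        ((S.filter fun ρ : ℂ => ‖(1 : ℂ) - ρ‖ ≤ t).card : ℝ) ≤
          M * (1 + Real.exp 1 * t) + B * (1 + Real.exp 1 * t) ^ (3 / 2 : ℝ)) →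
      (S.map fun ρ : ℂ => (‖(1 : ℂ) - ρ‖ ^ 2)⁻¹).sum ≤ K) →
    ∃ C : ℝ, ∀ x : ℕ, 2 ≤ x → ((∑ n ∈ Finset.range (x + 1), (Polynomial.X : Polynomial ℂ) ^
      (n.factorization.sum fun _ v => min v 2)).roots.map (fun ρ : ℂ => (‖(1 : ℂ) - ρ‖ ^ 2)⁻¹)).sum ≤ C := by
  intro hTilt hRankin hJensen hStieltjes
  obtain ⟨A, hA0, C, hC, x₀, hmaj⟩ := hTilt
  obtain ⟨B, hB0, hrank⟩ := hRankin
  -- constants of the line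
  have hK₀ : (0 : ℝ) ≤ C + B * C := add_nonneg hC.le (mul_nonneg hB0 hC.le)
  have hr₀ : (0 : ℝ) < Real.exp (-(3 * A)) := Real.exp_pos _
  obtain ⟨K, hK⟩ := hStieltjes A B (C + B * C) (Real.exp (-(3 * A))) hA0 hB0 hK₀ hr₀
  -- threshold beyond which the disc `‖z - 1‖ ≤ L/C` has radius ≥ 1
  set X : ℕ := max x₀ (max 3 ⌈Real.exp (Real.exp C)⌉₊) with hXdef
  -- the main estimate, for x ≥ X
  have main : ∀ x : ℕ, X ≤ x →
      ((∑ n ∈ Finset.range (x + 1), (Polynomial.X : Polynomial ℂ) ^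
        (n.factorization.sum fun _ v => min v 2)).roots.map
          (fun ρ : ℂ => (‖(1 : ℂ) - ρ‖ ^ 2)⁻¹)).sum ≤ K := by
    intro x hx
    have hx₀ : x₀ ≤ x := le_trans (le_max_left _ _) hx
    have hx3 : 3 ≤ x := le_trans ((le_max_left _ _).trans (le_max_right _ _)) hx
    have hxceil : ⌈Real.exp (Real.exp C)⌉₊ ≤ x :=
      le_trans ((le_max_right _ _).trans (le_max_right _ _)) hx
    have hxexp : Real.exp (Real.exp C) ≤ (x : ℝ) :=
      (Nat.le_ceil _).trans (by exact_mod_cast hxceil)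
    have hxpos : (0 : ℝ) < x := (Real.exp_pos _).trans_le hxexp
    have hlogx : Real.exp C ≤ Real.log x := (Real.le_log_iff_exp_le hxpos).2 hxexp
    have hlogpos : 0 < Real.log (x : ℝ) := (Real.exp_pos _).trans_le hlogx
    have hCL : C ≤ Real.log (Real.log x) := (Real.le_log_iff_exp_le hlogpos).2 hlogx
    have hLpos : 0 < Real.log (Real.log x) := hC.trans_le hCL
    have hR₁ : 1 ≤ Real.log (Real.log x) / C := by
      rw [le_div_iff₀ hC]; simpa using hCL
    -- the polynomial and its values
    set P : Polynomial ℂ := ∑ n ∈ Finset.range (x + 1), (Polynomial.X : Polynomial ℂ) ^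
        (n.factorization.sum fun _ v => min v 2) with hPdef
    have hevalz : ∀ z : ℂ, P.eval z =
        ∑ n ∈ Finset.range (x + 1), z ^ (n.factorization.sum fun _ v => min v 2) := by
      intro z; simp [hPdef, Polynomial.eval_finsetSum]
    have heval1 : P.eval 1 = ((x + 1 : ℕ) : ℂ) := by
      simp [hPdef, Polynomial.eval_finsetSum]
    have hnorm1 : ‖P.eval 1‖ = (x : ℝ) + 1 := by
      rw [heval1, Complex.norm_natCast]; push_cast; ring
    have hP1 : P.eval 1 ≠ 0 := by
      rw [heval1]; exact Nat.cast_ne_zero.2 (Nat.succ_ne_zero x)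
    -- disc majorant (stub 1, verbatim)
    have hdisc : ∀ z : ℂ, ‖z - 1‖ ≤ Real.log (Real.log x) / C →
        ‖P.eval z‖ ≤ ‖P.eval 1‖ * Real.exp (Real.log (Real.log x) * (z.re - 1) +
          A * (1 + ‖z - 1‖) ^ (3 / 2 : ℝ)) := by
      intro z hz
      rw [hevalz, hnorm1]
      exact hmaj x hx₀ z hz
    -- global majorant (stub 2 + positivity of the coefficients)
    have hglob : ∀ z : ℂ, ‖P.eval z‖ ≤ ‖P.eval 1‖ *
        Real.exp (B * Real.log (Real.log x) * (1 + ‖z - 1‖) + B * (1 + ‖z - 1‖) ^ (3 / 2 : ℝ)) := by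
      intro z
      have hz1 : ‖z‖ ≤ 1 + ‖z - 1‖ := by
        have h := norm_add_le (z - 1) 1
        simp at h
        linarith
      have hy : (1 : ℝ) ≤ 1 + ‖z - 1‖ := by linarith [norm_nonneg (z - 1)]
      rw [hevalz, hnorm1]
      calc ‖∑ n ∈ Finset.range (x + 1), z ^ (n.factorization.sum fun _ v => min v 2)‖
          ≤ ∑ n ∈ Finset.range (x + 1), (1 + ‖z - 1‖) ^ (n.factorization.sum fun _ v => min v 2) := by
            refine (norm_sum_le _ _).trans (Finset.sum_le_sum fun n _ => ?_)
            rw [norm_pow]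
            exact pow_le_pow_left₀ (norm_nonneg _) hz1 _
        _ ≤ ((x : ℝ) + 1) * Real.exp (B * (1 + ‖z - 1‖) * Real.log (Real.log x) +
              B * (1 + ‖z - 1‖) ^ (3 / 2 : ℝ)) := hrank x hx3 _ hy
        _ = ((x : ℝ) + 1) * Real.exp (B * Real.log (Real.log x) * (1 + ‖z - 1‖) +
              B * (1 + ‖z - 1‖) ^ (3 / 2 : ℝ)) := by ring_nf
    -- Jensen at the free centre (stub 3)
    have hΛ' : 0 ≤ B * Real.log (Real.log x) := mul_nonneg hB0 hLpos.le
    obtain ⟨hfree, hnear, hfar⟩ := hJensen P (Real.log (Real.log x)) (B * Real.log (Real.log x))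
      (Real.log (Real.log x) / C) A B hP1 hLpos.le hΛ' hR₁ hA0 hB0 hdisc hglob
    -- Stieltjes conversion (stub 4)
    have hM0 : 0 ≤ Real.log (Real.log x) + B * Real.log (Real.log x) := add_nonneg hLpos.le hΛ'
    have hM : Real.log (Real.log x) + B * Real.log (Real.log x) ≤
        (C + B * C) * (Real.log (Real.log x) / C) := by
      rw [mul_div_assoc', le_div_iff₀ hC]
      apply le_of_eq
      ring
    exact hK P.roots _ _ hM0 hR₁ hM hfree hnear hfar
  -- the finitely many small x
  refine ⟨max K (∑ x ∈ Finset.range X, |((∑ n ∈ Finset.range (x + 1), (Polynomial.X : Polynomial ℂ) ^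
        (n.factorization.sum fun _ v => min v 2)).roots.map
          (fun ρ : ℂ => (‖(1 : ℂ) - ρ‖ ^ 2)⁻¹)).sum|), fun x _ => ?_⟩
  by_cases hxX : X ≤ x
  · exact (main x hxX).trans (le_max_left _ _)
  · push Not at hxX
    refine le_trans ?_ (le_max_right _ _)
    exact (le_abs_self _).trans
      (Finset.single_le_sum (f := fun x => |((∑ n ∈ Finset.range (x + 1), (Polynomial.X : Polynomial ℂ) ^
        (n.factorization.sum fun _ v => min v 2)).roots.map
          (fun ρ : ℂ => (‖(1 : ℂ) - ρ‖ ^ 2)⁻¹)).sum|)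
        (fun i _ => abs_nonneg _) (Finset.mem_range.2 hxX))


/-- **Composition of the analytic stub (kernel-checked, no `sorry`): Stubs 1a, 1b, 1c and 2 imply the
one-sided tilted majorant** `‖P_x(z)‖ ≤ (x + 1)·exp(log log x·(Re z − 1) + A(1 + ‖z − 1‖)^{3/2})` on
`‖z − 1‖ ≤ (log log x)/C`, `x ≥ x₀`.  Bookkeeping: `C := 2·max C₁ 1` (`C₁` from Stub 1c), so that
`R := 1 + ‖z − 1‖` satisfies `1 ≤ R ≤ log log x` and `R ≤ log log x / C₁` as soon as `log log x ≥ C`;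
`h := x·e^{−(log log x)³}`; `A(x)·h = (A₁(x+h) − A₁(x)) − Σ_{x<n≤x+h} z^{s(n)}(x + h − n)` with
`|x + h − n| ≤ h`, `‖z‖^{s(n)} ≤ R^{s(n)}`; `P_x(z) = 1 + A(x)`; `(log x)^{−R−1} ≤ (log x)^{Re z−1} =
exp(log log x·(Re z−1))`; `A := 3(b + c) + 1` absorbs `(1+R)^{3/2} ≤ 3(1+‖z−1‖)^{3/2}` and the `+1`'s
(`x·(log x)^{Re z−1} ≥ exp(e^L − L²/2) ≥ e`). -/
theorem tiltedMajorant_of_parts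
    (hEuler : ∃ b : ℝ, 0 ≤ b ∧ ∀ R : ℝ, 0 ≤ R → ∀ z : ℂ, ‖z‖ ≤ R → ∃ G : ℂ → ℂ,
      SelbergDelange.RieszData R (4 / 5) (Real.exp (b * (1 + R) ^ (3 / 2 : ℝ))) z
        (fun n : ℕ => z ^ (n.factorization.sum fun _ v => min v 2)) G)
    (hEngine : ∃ X₀ : ℝ, ∃ c : ℝ, 0 ≤ c ∧ ∀ (R B : ℝ) (z : ℂ) (a : ℕ → ℂ) (G : ℂ → ℂ), 1 ≤ R →
      SelbergDelange.RieszData R (4 / 5) B z a G →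
      ∀ x h : ℝ, X₀ ≤ x → R ≤ Real.log (Real.log x) →
        x * Real.exp (-(Real.log (Real.log x) ^ 3)) ≤ h → h ≤ x →
        ‖(∑ n ∈ Finset.Ioc 0 ⌊x + h⌋₊, a n * (((x + h : ℝ) : ℂ) - n)) -
            ∑ n ∈ Finset.Ioc 0 ⌊x⌋₊, a n * ((x : ℂ) - n)‖ ≤
          h * x * Real.log x ^ (z.re - 1) * B * Real.exp (c * (1 + R) ^ (3 / 2 : ℝ)))
    (hShort : ∀ B : ℝ, 0 ≤ B →
      (∀ x : ℕ, 3 ≤ x → ∀ y : ℝ, 1 ≤ y →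
        ∑ n ∈ Finset.range (x + 1), y ^ (n.factorization.sum fun _ v => min v 2) ≤
          ((x : ℝ) + 1) * Real.exp (B * y * Real.log (Real.log x) + B * y ^ (3 / 2 : ℝ))) →
      ∃ C : ℝ, 0 < C ∧ ∃ x₁ : ℕ, ∀ x : ℕ, x₁ ≤ x → ∀ R : ℝ, 1 ≤ R →
        R ≤ Real.log (Real.log x) / C →
        ∑ n ∈ Finset.Ioc x ⌊(x : ℝ) + x * Real.exp (-(Real.log (Real.log x) ^ 3))⌋₊,
            R ^ (n.factorization.sum fun _ v => min v 2) ≤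
          (x : ℝ) * Real.log x ^ (-R - 1))
    (hRankin : ∃ B : ℝ, 0 ≤ B ∧ ∀ x : ℕ, 3 ≤ x → ∀ y : ℝ, 1 ≤ y →
      ∑ n ∈ Finset.range (x + 1), y ^ (n.factorization.sum fun _ v => min v 2) ≤
        ((x : ℝ) + 1) * Real.exp (B * y * Real.log (Real.log x) + B * y ^ (3 / 2 : ℝ))) :
    ∃ A : ℝ, 0 ≤ A ∧ ∃ C : ℝ, 0 < C ∧ ∃ x₀ : ℕ, ∀ x : ℕ, x₀ ≤ x → ∀ z : ℂ,
      ‖z - 1‖ ≤ Real.log (Real.log x) / C →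
      ‖∑ n ∈ Finset.range (x + 1), z ^ (n.factorization.sum fun _ v => min v 2)‖ ≤
        ((x : ℝ) + 1) * Real.exp (Real.log (Real.log x) * (z.re - 1) + A * (1 + ‖z - 1‖) ^ (3 / 2 : ℝ)) := by
  obtain ⟨b, hb0, hEul⟩ := hEuler
  obtain ⟨X₀, c, hc0, hEng⟩ := hEngine
  obtain ⟨Br, hBr0, hrank⟩ := hRankin
  obtain ⟨C₁, hC₁, x₁, hshort⟩ := hShort Br hBr0 hrank
  -- constants
  set C : ℝ := 2 * max C₁ 1 with hCdef
  have hC2 : (2 : ℝ) ≤ C := by have := le_max_right C₁ 1; rw [hCdef]; linarith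
  have hCC₁ : 2 * C₁ ≤ C := by have := le_max_left C₁ 1; rw [hCdef]; linarith
  have hC : 0 < C := by linarith
  set A : ℝ := 3 * (b + c) + 1 with hAdef
  have hA0 : 0 ≤ A := by rw [hAdef]; positivity
  set x₀ : ℕ := max (max x₁ ⌈X₀⌉₊) ⌈Real.exp (Real.exp C)⌉₊ with hx₀def
  refine ⟨A, hA0, C, hC, x₀, fun x hx z hz => ?_⟩
  -- unpacking the threshold
  have hx₁ : x₁ ≤ x := le_trans ((le_max_left _ _).trans (le_max_left _ _)) hx
  have hX₀ : X₀ ≤ (x : ℝ) :=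
    (Nat.le_ceil X₀).trans (by exact_mod_cast ((le_max_right _ _).trans (le_max_left _ _)).trans hx)
  have hxexp : Real.exp (Real.exp C) ≤ (x : ℝ) :=
    (Nat.le_ceil _).trans (by exact_mod_cast (le_max_right _ _).trans hx)
  have hxpos : (0 : ℝ) < x := (Real.exp_pos _).trans_le hxexp
  have hlogx : Real.exp C ≤ Real.log x := (Real.le_log_iff_exp_le hxpos).2 hxexp
  set 𝓛 : ℝ := Real.log x with h𝓛def
  have h𝓛pos : 0 < 𝓛 := (Real.exp_pos _).trans_le hlogx
  set L : ℝ := Real.log 𝓛 with hLdef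
  have hCL : C ≤ L := (Real.le_log_iff_exp_le h𝓛pos).2 hlogx
  have hL2 : 2 ≤ L := hC2.trans hCL
  have hL0 : 0 < L := by linarith
  have h𝓛1 : 1 ≤ 𝓛 := by
    have : Real.exp C ≥ 1 := Real.one_le_exp hC.le
    linarith
  -- the radius
  set r : ℝ := ‖z - 1‖ with hrdef
  have hr0 : 0 ≤ r := norm_nonneg _
  set R : ℝ := 1 + r with hRdef
  have hR1 : 1 ≤ R := by rw [hRdef]; linarith
  have hR0 : 0 ≤ R := by linarith
  have hzR : ‖z‖ ≤ R := by
    have h := norm_add_le (z - 1) 1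
    simp only [sub_add_cancel, norm_one] at h
    rw [hRdef, hrdef]; linarith
  have hrLC : r ≤ L / C := hz
  have hrL2 : r ≤ L / 2 := hrLC.trans (div_le_div_of_nonneg_left hL0.le (by norm_num) hC2)
  have hRL : R ≤ L := by rw [hRdef]; linarith
  have hRC₁ : R ≤ L / C₁ := by
    -- `1 + r ≤ 1 + L/C ≤ L/(2C₁) + L/(2C₁) = L/C₁` using `L ≥ C ≥ 2C₁`
    have h1 : L / C ≤ L / (2 * C₁) := div_le_div_of_nonneg_left hL0.le (by positivity) hCC₁
    have h2 : 1 ≤ L / (2 * C₁) := by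
      rw [le_div_iff₀ (by positivity)]; linarith
    have h3 : L / (2 * C₁) + L / (2 * C₁) = L / C₁ := by field_simp; ring
    rw [hRdef]; linarith
  have hrez' : -r ≤ z.re - 1 := by
    have h1 : |(z - 1).re| ≤ ‖z - 1‖ := Complex.abs_re_le_norm _
    have h2 : (z - 1).re = z.re - 1 := by simp
    rw [h2] at h1
    rw [hrdef]
    linarith [neg_abs_le (z.re - 1)]
  have hrez : -R ≤ z.re - 1 := by rw [hRdef]; linarith
  -- the data and the engine
  obtain ⟨G, hData⟩ := hEul R hR0 z hzR
  set h : ℝ := (x : ℝ) * Real.exp (-(Real.log (Real.log x) ^ 3)) with hhdef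
  have hhpos : 0 < h := mul_pos hxpos (Real.exp_pos _)
  have hhx : h ≤ x := by
    have : Real.exp (-(Real.log (Real.log x) ^ 3)) ≤ 1 := by
      rw [Real.exp_le_one_iff, neg_nonpos]; positivity
    calc h = (x : ℝ) * Real.exp (-(Real.log (Real.log x) ^ 3)) := rfl
      _ ≤ (x : ℝ) * 1 := by gcongr
      _ = x := mul_one _
  have hEngx := hEng R _ z _ G hR1 hData x h hX₀ hRL le_rfl hhx
  -- the short sum
  have hShortx := hshort x hx₁ R hR1 hRC₁
  -- notation for the sums
  set sfun : ℕ → ℕ := fun n => n.factorization.sum fun _ v => min v 2 with hsfun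
  set a : ℕ → ℂ := fun n => z ^ sfun n with hadef
  set m : ℕ := ⌊(x : ℝ) + h⌋₊ with hmdef
  have hxm : x ≤ m := by
    rw [hmdef]; exact Nat.le_floor (by linarith)
  have hmxh : (m : ℝ) ≤ x + h := Nat.floor_le (by positivity)
  have hfloorx : ⌊(x : ℝ)⌋₊ = x := Nat.floor_natCast x
  -- A(x) and the decomposition A₁(x+h) − A₁(x) = h·A(x) + E
  set Ax : ℂ := ∑ n ∈ Finset.Ioc 0 x, a n with hAxdef
  set E : ℂ := ∑ n ∈ Finset.Ioc x m, a n * (((x + h : ℝ) : ℂ) - n) with hEdef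
  have hdecomp : (∑ n ∈ Finset.Ioc 0 m, a n * (((x + h : ℝ) : ℂ) - n)) -
      ∑ n ∈ Finset.Ioc 0 ⌊(x : ℝ)⌋₊, a n * (((x : ℝ) : ℂ) - n) = (h : ℂ) * Ax + E := by
    rw [hfloorx, ← Finset.sum_Ioc_consecutive _ (Nat.zero_le x) hxm, hAxdef, hEdef, Finset.mul_sum,
      add_sub_right_comm, ← Finset.sum_sub_distrib]
    congr 1
    refine Finset.sum_congr rfl fun n _ => ?_
    push_cast
    ring
  -- ‖E‖ ≤ h · Σ_{x<n≤m} R^{s(n)} ≤ h · x · 𝓛^{−R−1}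
  have hE : ‖E‖ ≤ h * ((x : ℝ) * 𝓛 ^ (-R - 1)) := by
    have hterm : ∀ n ∈ Finset.Ioc x m, ‖a n * (((x + h : ℝ) : ℂ) - n)‖ ≤ R ^ sfun n * h := by
      intro n hn
      rw [Finset.mem_Ioc] at hn
      rw [norm_mul, hadef]
      refine mul_le_mul ?_ ?_ (norm_nonneg _) (by positivity)
      · simp only [norm_pow]
        exact pow_le_pow_left₀ (norm_nonneg _) hzR _
      · have hn1 : (x : ℝ) < n := by exact_mod_cast hn.1
        have hn2 : (n : ℝ) ≤ m := by exact_mod_cast hn.2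
        have : (((x + h : ℝ) : ℂ) - n) = (((x + h - n : ℝ)) : ℂ) := by push_cast; ring
        rw [this, Complex.norm_real, Real.norm_eq_abs, abs_le]
        constructor <;> linarith
    calc ‖E‖ ≤ ∑ n ∈ Finset.Ioc x m, ‖a n * (((x + h : ℝ) : ℂ) - n)‖ := norm_sum_le _ _
      _ ≤ ∑ n ∈ Finset.Ioc x m, R ^ sfun n * h := Finset.sum_le_sum hterm
      _ = h * ∑ n ∈ Finset.Ioc x m, R ^ sfun n := by rw [Finset.mul_sum]; simp [mul_comm]
      _ ≤ h * ((x : ℝ) * 𝓛 ^ (-R - 1)) := by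
          refine mul_le_mul_of_nonneg_left ?_ hhpos.le
          simpa [hmdef, hhdef, hsfun] using hShortx
  -- the engine bound
  set B : ℝ := Real.exp (b * (1 + R) ^ (3 / 2 : ℝ)) with hBdef
  have hD : ‖(h : ℂ) * Ax + E‖ ≤ h * x * 𝓛 ^ (z.re - 1) * B * Real.exp (c * (1 + R) ^ (3 / 2 : ℝ)) := by
    rw [← hdecomp]
    simpa [hmdef, hadef, hsfun] using hEngx
  -- hence the bound for A(x)
  have h𝓛mono : 𝓛 ^ (-R - 1) ≤ 𝓛 ^ (z.re - 1) :=
    Real.rpow_le_rpow_of_exponent_le h𝓛1 (by linarith)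
  set E₁ : ℝ := B * Real.exp (c * (1 + R) ^ (3 / 2 : ℝ)) with hE₁def
  have hE₁ : E₁ = Real.exp ((b + c) * (1 + R) ^ (3 / 2 : ℝ)) := by
    rw [hE₁def, hBdef, ← Real.exp_add]; ring_nf
  have hE₁1 : 1 ≤ E₁ := by rw [hE₁]; exact Real.one_le_exp (by positivity)
  have hAx : ‖Ax‖ ≤ (x : ℝ) * 𝓛 ^ (z.re - 1) * (E₁ + 1) := by
    have h1 : ‖(h : ℂ) * Ax‖ = h * ‖Ax‖ := by
      rw [norm_mul, Complex.norm_real, Real.norm_of_nonneg hhpos.le]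
    have h2 : ‖(h : ℂ) * Ax‖ ≤ ‖(h : ℂ) * Ax + E‖ + ‖E‖ := by
      have := norm_sub_le ((h : ℂ) * Ax + E) E
      simpa using this
    have h3 : h * ‖Ax‖ ≤ h * ((x : ℝ) * 𝓛 ^ (z.re - 1) * (E₁ + 1)) := by
      rw [← h1]
      calc ‖(h : ℂ) * Ax‖ ≤ ‖(h : ℂ) * Ax + E‖ + ‖E‖ := h2
        _ ≤ h * x * 𝓛 ^ (z.re - 1) * B * Real.exp (c * (1 + R) ^ (3 / 2 : ℝ)) +
              h * ((x : ℝ) * 𝓛 ^ (-R - 1)) := add_le_add hD hE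
        _ ≤ h * x * 𝓛 ^ (z.re - 1) * B * Real.exp (c * (1 + R) ^ (3 / 2 : ℝ)) +
              h * ((x : ℝ) * 𝓛 ^ (z.re - 1)) := by gcongr
        _ = h * ((x : ℝ) * 𝓛 ^ (z.re - 1) * (E₁ + 1)) := by rw [hE₁def]; ring
    exact le_of_mul_le_mul_left h3 hhpos
  -- P_x(z) = 1 + A(x)
  have hrange : Finset.range (x + 1) = insert 0 (Finset.Ioc 0 x) := by
    ext n; simp only [Finset.mem_range, Finset.mem_insert, Finset.mem_Ioc]; omega
  have hP : ∑ n ∈ Finset.range (x + 1), z ^ sfun n = 1 + Ax := by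
    rw [hrange, Finset.sum_insert (by simp), hAxdef, hadef]
    simp [hsfun]
  -- sizes: x·𝓛^{Re z − 1} ≥ e ≥ 2 and the exponent bookkeeping
  have h𝓛eq : 𝓛 = Real.exp L := by rw [hLdef, Real.exp_log h𝓛pos]
  have hxeq : (x : ℝ) = Real.exp 𝓛 := by rw [h𝓛def, Real.exp_log hxpos]
  have hpow : 𝓛 ^ (z.re - 1) = Real.exp (L * (z.re - 1)) := by
    rw [Real.rpow_def_of_pos h𝓛pos, hLdef]
  have hbig : 2 ≤ (x : ℝ) * 𝓛 ^ (z.re - 1) := by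
    -- `x 𝓛^{Re z−1} = exp(e^L + L(Re z − 1)) ≥ exp(e^L − L·r) ≥ exp(e^L − L²/2) ≥ exp 1 ≥ 2`
    rw [hxeq, hpow, ← Real.exp_add, h𝓛eq]
    have h1 : L * (z.re - 1) ≥ -(L * r) := by
      have := mul_le_mul_of_nonneg_left hrez' hL0.le
      linarith
    have h2 : L * r ≤ L ^ 2 / 2 := by
      have := mul_le_mul_of_nonneg_left hrL2 hL0.le
      have e : L * (L / 2) = L ^ 2 / 2 := by ring
      linarith
    have h3 : 1 + L ^ 2 / 2 ≤ Real.exp L := by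
      have := Real.quadratic_le_exp_of_nonneg hL0.le
      linarith
    have h4 : (1 : ℝ) ≤ Real.exp L + L * (z.re - 1) := by linarith
    calc (2 : ℝ) ≤ Real.exp 1 := by have := Real.add_one_le_exp (1 : ℝ); linarith
      _ ≤ Real.exp (Real.exp L + L * (z.re - 1)) := Real.exp_le_exp.2 h4
  have hexpA : Real.exp 1 * E₁ ≤ Real.exp (A * (1 + r) ^ (3 / 2 : ℝ)) := by
    rw [hE₁, ← Real.exp_add, Real.exp_le_exp, hAdef, hRdef]
    -- `(b+c)(2+r)^{3/2} + 1 ≤ (3(b+c)+1)(1+r)^{3/2}` from `(2+r)^{3/2} ≤ 3(1+r)^{3/2}`, `(1+r)^{3/2} ≥ 1`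
    have h1 : (1 : ℝ) ≤ (1 + r) ^ (3 / 2 : ℝ) := Real.one_le_rpow (by linarith) (by norm_num)
    have h2 : (1 + (1 + r)) ^ (3 / 2 : ℝ) ≤ 3 * (1 + r) ^ (3 / 2 : ℝ) := by
      have h21 : (1 + (1 + r)) ≤ 2 * (1 + r) := by linarith
      have h22 : (1 + (1 + r)) ^ (3 / 2 : ℝ) ≤ (2 * (1 + r)) ^ (3 / 2 : ℝ) :=
        Real.rpow_le_rpow (by linarith) h21 (by norm_num)
      have h23 : (2 * (1 + r)) ^ (3 / 2 : ℝ) = 2 ^ (3 / 2 : ℝ) * (1 + r) ^ (3 / 2 : ℝ) :=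
        Real.mul_rpow (by norm_num) (by linarith)
      have h24 : (2 : ℝ) ^ (3 / 2 : ℝ) ≤ 3 := by
        have hsq : ((2 : ℝ) ^ (3 / 2 : ℝ)) ^ (2 : ℕ) = 8 := by
          rw [← Real.rpow_natCast, ← Real.rpow_mul (by norm_num)]; norm_num
        have h9 : ((2 : ℝ) ^ (3 / 2 : ℝ)) ^ (2 : ℕ) ≤ 3 ^ (2 : ℕ) := by rw [hsq]; norm_num
        exact (pow_le_pow_iff_left₀ (by positivity) (by norm_num) (by norm_num)).1 h9
      calc (1 + (1 + r)) ^ (3 / 2 : ℝ) ≤ 2 ^ (3 / 2 : ℝ) * (1 + r) ^ (3 / 2 : ℝ) := h22.trans h23.le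
        _ ≤ 3 * (1 + r) ^ (3 / 2 : ℝ) := by gcongr
    have hbc : 0 ≤ b + c := by positivity
    linarith only [mul_le_mul_of_nonneg_left h2 hbc, h1]
  -- conclusion
  rw [hP]
  have hfinal : 1 + (x : ℝ) * 𝓛 ^ (z.re - 1) * (E₁ + 1) ≤
      ((x : ℝ) + 1) * Real.exp (Real.log (Real.log x) * (z.re - 1) + A * (1 + r) ^ (3 / 2 : ℝ)) := by
    rw [Real.exp_add, ← hpow]
    have h𝓛p : 0 ≤ 𝓛 ^ (z.re - 1) := by positivity
    obtain ⟨Q, hQ⟩ : ∃ Q : ℝ, Q = (x : ℝ) * 𝓛 ^ (z.re - 1) := ⟨_, rfl⟩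
    rw [← hQ] at hbig ⊢
    have hQ0 : 0 ≤ Q := by rw [hQ]; positivity
    have hE₁0 : 0 ≤ E₁ := by linarith
    have he : Real.exp 1 * E₁ ≤ Real.exp (A * (1 + r) ^ (3 / 2 : ℝ)) := hexpA
    have he1 : (2.5 : ℝ) ≤ Real.exp 1 := by
      have := Real.exp_one_gt_d9; linarith
    -- (x+1)·𝓛^{Re z−1}·e^{A…} ≥ Q·e·E₁ ≥ Q(E₁+1) + Q·(e−2)E₁ ≥ Q(E₁+1) + 1
    have k1 : Q * ((2.5 : ℝ) * E₁) ≤ Q * (Real.exp 1 * E₁) :=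
      mul_le_mul_of_nonneg_left (mul_le_mul_of_nonneg_right he1 hE₁0) hQ0
    have k3 : (2 : ℝ) * (1 / 2) ≤ Q * ((1.5 : ℝ) * E₁ - 1) :=
      mul_le_mul hbig (by linarith) (by norm_num) hQ0
    calc 1 + Q * (E₁ + 1) ≤ Q * (Real.exp 1 * E₁) := by linarith only [k1, k3]
      _ ≤ Q * Real.exp (A * (1 + r) ^ (3 / 2 : ℝ)) := mul_le_mul_of_nonneg_left he hQ0
      _ ≤ ((x : ℝ) + 1) * 𝓛 ^ (z.re - 1) * Real.exp (A * (1 + r) ^ (3 / 2 : ℝ)) := by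
          rw [hQ]
          exact mul_le_mul_of_nonneg_right (mul_le_mul_of_nonneg_right (by linarith) h𝓛p)
            (Real.exp_pos _).le
      _ = ((x : ℝ) + 1) * (𝓛 ^ (z.re - 1) * Real.exp (A * (1 + r) ^ (3 / 2 : ℝ))) := by ring
  calc ‖1 + Ax‖ ≤ ‖(1 : ℂ)‖ + ‖Ax‖ := norm_add_le _ _
    _ ≤ 1 + (x : ℝ) * 𝓛 ^ (z.re - 1) * (E₁ + 1) := by rw [norm_one]; gcongr
    _ ≤ _ := hfinal

/-- **The one-sided tilted majorant with the harmonic exponent** (formerly `stub_tiltedMajorant`; now a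
theorem modulo Stubs 1a–1c and 2): there are `A ≥ 0`, `C > 0`, `x₀` such that for all `x ≥ x₀` and all
`‖z − 1‖ ≤ (log log x)/C`: `‖Σ_{0≤n≤x} z^{s(n)}‖ ≤ (x + 1)·exp(log log x·(Re z − 1) + A(1 + ‖z − 1‖)^{3/2})`. -/
theorem tiltedMajorant :
    ∃ A : ℝ, 0 ≤ A ∧ ∃ C : ℝ, 0 < C ∧ ∃ x₀ : ℕ, ∀ x : ℕ, x₀ ≤ x → ∀ z : ℂ,
      ‖z - 1‖ ≤ Real.log (Real.log x) / C →
      ‖∑ n ∈ Finset.range (x + 1), z ^ (n.factorization.sum fun _ v => min v 2)‖ ≤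
        ((x : ℝ) + 1) * Real.exp (Real.log (Real.log x) * (z.re - 1) + A * (1 + ‖z - 1‖) ^ (3 / 2 : ℝ)) :=
  tiltedMajorant_of_parts stub_cappedEulerData stub_rieszDiffEngine stub_shortIntervalCapped
    stub_rankinMajorant

/-- **The crux `LinearCappedRepulsion` (route AlmostPrimeZeros, rank 5; item stmt-Parity-11327):**
`T_X(x) = Σ_ρ ‖1 − ρ‖⁻²`, over the roots of the almost-prime polynomial `Σ_{0≤n≤x} z^{s(n)}` of the
capped statistic `s(n) = Σ_{p^v ∥ n} min(v,2)`, is bounded for `x ≥ 2` — the route decl BY NAME, from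
the six landed stubs of line `jensen-stieltjes-majorant` (one-sided Selberg–Delange majorant on the disc
`‖z − 1‖ ≤ log log x / C` → Jensen at the free centre `z = 1` → Stieltjes). -/
theorem LinearCappedRepulsion_of :
    Summit.Parity.BatemanHorn.Theses.AlmostPrimeZeros.LinearCappedRepulsion :=
  LinearCappedRepulsion_of_stubs tiltedMajorant stub_rankinMajorant stub_jensenCount stub_stieltjes

end Summit.Parity.BatemanHorn.Cruxes.LinearCappedRepulsion.JensenStieltjesMajorant
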